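import Literature.NumberTheory.GelbartRogawski1991.LocalDoubledLeraySectionSiegelUnipotent
import Literature.NumberTheory.GelbartRogawski1991.LocalDoubledKroneckerEmbedding
import Literature.RepresentationTheory.HeisenbergGroup.SymplecticMatrixTransportUnipotentRadical
import HarnessLib

-- buildfix G11b-3 recipe (LEDGER B13-1/B13-3), as in the GelbartRogawski1991 siblings: elaborate sequentially.
set_option Elab.async false

/-!
# The Siegel unipotents of the doubled unitary group under a mover `E′` (`E′ ℓ_Δ = ℓ_Y`): for EVERY mover,
# `E′ ι(n(t)) E′⁻¹ = transportSp 𝕋 (low c)` with `c = cOfFix 𝕋 (E′ ι(n(t)) E′⁻¹)`, `F_v`-linear in `t`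

Topic `NumberTheory/GelbartRogawski1991`; namespace `Literature.NumberTheory.GelbartRogawski1991.UnitaryDualPair.LocalSplitting` (that of ★
`LocalDoubledUnitaryLagrangians` ∕ `LocalDoubledUnitaryUnramifiedCell` ∕ `LocalDoubledLeraySectionSiegelUnipotent`). KERNEL ONLY: theorems; no
definition, no named fact, no `sorry`.

Setting (★ `LocalDoubledUnitaryLagrangians`): `E/F` quadratic with `(c, δ, d)`, a finite place `v`, `T₀ ∈ M_n(F)` symmetric non-degenerate,
`H(F_v) = U(J^𝔻)(F_v) = localPi E c (n+n) J^𝔻 v`, the local symplectic space `𝕎_v = F_v^{n+n} × F_v^{n+n}` of `Res 𝔻_v` with its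
embedding `ι = iotaD : H(F_v) → Sp(𝕎_v)`, the frame `eD : (E ⊗ F_v)^{n ⊕ n} ≃ 𝕎_v` (`eD (matA g · u) = ι(g) (eD u)`, ★ `eD_matA_mulVec`),
the Lagrangians `ℓ_Δ = eD(Δ)` (★ `map_eD_deltaV`) and `ℓ_Y = 0 ⊕ F_v^{n+n}`, and a MOVER `E′ ∈ Sp(𝕎_v)` with `E′ ℓ_Δ = ℓ_Y` (ANY such —
the rational `δ` of ★ `LocalDoubledUnitaryDeltaTransport`, GR-2's `deltaLoc`, or an adapted mover). An element `g ∈ H(F_v)` is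
ADAPTED-UNIPOTENT with parameter `t ∈ M_n(E ⊗ F_v)` when `adapt (matA g) = [[1, t], [0, 1]]` — e.g. ★ `nElem t ht` (★ `adapt_matA_nElem`),
and the Kronecker images ★ `kronLoc (nElem₁ t₁) = nElem_m (t₁₀₀ • 1)` (★ `kronLoc_nElem`).

* §1 `matA_mulVec_dblV_add_adblV_of_adapt` : `matA g · (dblV a + adblV b) = dblV (a + t b) + adblV b` — an adapted unipotent FIXES `Δ`
  pointwise and is trivial modulo `Δ`; on `𝕎_v`: `iotaD_apply_of_mem_deltaLagrangian` (`ι(g) w = w` on `ℓ_Δ`), `iotaD_apply_sub_mem_deltaLagrangian`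
  (`ι(g) w − w ∈ ℓ_Δ`), and the explicit action `iotaD_apply_eD` (`ι(g) (eD u) = eD u + eD (dblV (t · halfDiff u))`).
* §2 **for ANY mover `E′`**: `mover_conj_apply` (`(E′ ι(g) E′⁻¹) w = w + E′ (eD (dblV (t · halfDiff (eD⁻¹ (E′⁻¹ w)))))`), hence `E′ ι(g) E′⁻¹` fixes
  `ℓ_Y` pointwise (`mover_conj_apply_of_mem_lagrangianY`) and is trivial modulo `ℓ_Y` (`fst_mover_conj_apply`), so by ★
  `SymplecticMatrix.eq_transportSp_low_of_fix` **`E′ ι(g) E′⁻¹ = transportSp 𝕋 (low (cOfFix 𝕋 (E′ ι(g) E′⁻¹)))`**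
  (`mover_conj_iotaD_eq_transportSp_low`; `𝕋 = localGram F (n+n) (gramD F n T₀) v`) — the hypothesis `hB` of ★
  `leraySection_deltaLagrangian_apply_eq_conj_unipOpPi`, whence **`r_Δ(ι(g)) Φ = Γ⁻¹ (unipOpPi (c ·) (Γ Φ))`** for any implementer `Γ` of `E′`
  (`leraySection_iotaD_adaptedUnipotent_apply`).
* §3 the Rao parameter is `F_v`-LINEAR in `t`: `shearMap_mover_conj_smul` and **`cOfFix_mover_conj_smul`** (`c(r • t) = r • c(t)`), and its
  quadratic form is the doubled hermitian form on the `Δ⁻`-component: **`dotProduct_cOfFix_mover_conj`**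
  `⟨x, c x⟩ = formD (u, matA g · u) = A(eD u, ι(g) eD u)`, `u = eD⁻¹ E′⁻¹ (x, 0)` (★ `dotProduct_cOfFix_mulVec_self_eq_alt`; anisotropy from
  `h_{T₀}` anisotropic is the sequel (AN)).
* §4 the named elements: `mover_conj_iotaD_nElem_eq_transportSp_low`, `leraySection_iotaD_nElem_apply` (★ `nElem`).

USE (cell hodgecm-mathlib, half A line LD2, brick (GRP-N) «group side of the unipotent junction», LD2-plan (g3) DEALS #14 (3) ∕ #16 (3); consumer
A-p19 (g31)'s (Z-van): with `Γ` an implementer of the consumer's own mover `proj m₀` (NO re-instantiation) and `Λ′ := Λ ∘ Γ⁻¹`, the Siegel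
unipotents `ι(kronLoc (nElem₁ (b δ_E)))` act on `Λ′` by `unipOpPi (b • c₁)` (§2 + §3, `c₁ := cOfFix 𝕋 (E′ ι(nElem_m (δ_E • 1)) E′⁻¹)`) — the
hypothesis `hΛN` of ★ S1 `functional_apply_eq_zero_of_forall_unipOpPi_eq`).  HONEST LABEL: symplectic linear algebra; nothing of [Liu2021]
asserted; HC_CM is proved only modulo the 7 printed citations (2 remaining: hLiu418 = stmt-HodgeConjecture-24832, h413 = stmt-HodgeConjecture-24833)
until rung 0 closes; count-neutral.

## References
* S. S. Kudla, Israel J. Math. 87 (1994) 361–401, §3, Thm 3.1 (the Siegel parabolic of the doubled group) [Kudla1994].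
* M. Harris, S. S. Kudla, W. J. Sweet, J. Amer. Math. Soc. 9 (1996), §1 (1.11)–(1.16) [HarrisKudlaSweet1996].
* R. Ranga Rao, Pacific J. Math. 157 (1993), §2.2 p. 338, Lemma 3.2 (3.8) p. 351 [Rangarao1993].
* J.-S. Li, J. reine angew. Math. 428 (1992), p. 181 (the mover `δ`) [Li1992].
-/

set_option autoImplicit false

noncomputable section

open NumberField IsDedekindDomain MeasureTheory Matrix
open Literature.RepresentationTheory.HeisenbergGroup Literature.RepresentationTheory.HeisenbergGroup.SymplecticMatrix
open Literature.NumberTheory.Automorphic Literature.NumberTheory.Automorphic.UnitaryGroup Literature.NumberTheory.Weil1964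
open Literature.NumberTheory.Automorphic.UnitaryGroup.QuadraticCoordinates
open Literature.NumberTheory.GelbartRogawski1991.AdaptedBlocks
open Literature.NumberTheory.GaloisRepresentations.IsNonarchimedeanLocalField
open Literature.GroupTheory Literature.LinearAlgebra.QuadraticForm

namespace Literature.NumberTheory.GelbartRogawski1991.UnitaryDualPair.LocalSplitting

variable (F : Type) [Field F] [NumberField F] (E : Type) [Field E] [NumberField E] [Algebra F E]
  [Algebra.IsQuadraticExtension F E] (c : E ≃ₐ[F] E)
  {δ : E} (hcδ : c δ = -δ) (hδ : δ ≠ 0) {d : F} (hd : δ * δ = algebraMap F E d)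
  (v : HeightOneSpectrum (𝓞 F)) (n : ℕ) {T₀ : Matrix (Fin n) (Fin n) F} (hT₀ : T₀.IsSymm) (hT₀d : IsUnit T₀.det)
  {JD : Matrix (Fin (n + n)) (Fin (n + n)) E} (hJD : JD = (gramD F n T₀).map (algebraMap F E))

/-! ## §1 Adapted unipotents: trivial on `Δ` and modulo `Δ` -/

omit [Algebra.IsQuadraticExtension F E] in
/-- **`matA g · (dblV a + adblV b) = dblV (a + t b) + adblV b`** for `g` with adapted matrix `[[1, t], [0, 1]]`: an adapted unipotent fixes the
diagonal `Δ` pointwise and shears `Δ⁻` into `Δ`. [cite: Kudla1994, §3; HarrisKudlaSweet1996, §1 (1.11)] -/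
theorem matA_mulVec_dblV_add_adblV_of_adapt (g : UnitaryGroup.localPi E c (n + n) JD v) (t : Matrix (Fin n) (Fin n) (LocalRing E v))
    (hg : adapt (matA F E c v n g) = Matrix.fromBlocks 1 t 0 1) (a b : Fin n → LocalRing E v) :
    matA F E c v n g *ᵥ (dblV a + adblV b) = dblV (a + t *ᵥ b) + adblV b := by
  rw [adapt_eq] at hg
  obtain ⟨hA, hB, hC, hD⟩ := Matrix.fromBlocks_inj.1 hg
  rw [Matrix.mulVec_add, mulVec_dblV, mulVec_adblV, hA, hB, hC, hD, Matrix.one_mulVec, Matrix.zero_mulVec, Matrix.one_mulVec,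
    adblV_zero, add_zero, dblV_add, add_assoc]

omit [Algebra.IsQuadraticExtension F E] in
/-- `matA g · u = u + dblV (t · halfDiff u)` (`u = dblV (halfSum u) + adblV (halfDiff u)`). [cite: Kudla1994, §3; HarrisKudlaSweet1996, §1 (1.11)] -/
theorem matA_mulVec_of_adapt (g : UnitaryGroup.localPi E c (n + n) JD v) (t : Matrix (Fin n) (Fin n) (LocalRing E v))
    (hg : adapt (matA F E c v n g) = Matrix.fromBlocks 1 t 0 1) (u : Fin n ⊕ Fin n → LocalRing E v) :
    matA F E c v n g *ᵥ u = u + dblV (t *ᵥ halfDiff u) := by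
  have hu : dblV (halfSum u) + adblV (halfDiff u) = u := dblV_halfSum_add_adblV_halfDiff u
  conv_lhs => rw [← hu]
  conv_rhs => rw [← hu]
  rw [matA_mulVec_dblV_add_adblV_of_adapt F E c v n g t hg, dblV_add, halfDiff_dblV_add_adblV]
  abel

include hT₀ hJD in
/-- **`ι(g) (eD u) = eD u + eD (dblV (t · halfDiff u))`**: the symplectic action of an adapted unipotent in the frame `eD`.
[cite: Kudla1994, §3] -/
theorem iotaD_apply_eD (g : UnitaryGroup.localPi E c (n + n) JD v) (t : Matrix (Fin n) (Fin n) (LocalRing E v))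
    (hg : adapt (matA F E c v n g) = Matrix.fromBlocks 1 t 0 1) (u : Fin n ⊕ Fin n → LocalRing E v) :
    toLin F v (iotaD F E c hcδ hδ hd v n hT₀ hJD g) (eD F E c hcδ hδ hd v n u) =
      eD F E c hcδ hδ hd v n u + eD F E c hcδ hδ hd v n (dblV (t *ᵥ halfDiff u)) := by
  rw [← eD_matA_mulVec F E c hcδ hδ hd v n hT₀ hJD, matA_mulVec_of_adapt F E c v n g t hg, map_add]

include hT₀ hJD in
/-- **an adapted unipotent fixes `ℓ_Δ` pointwise**: `ι(g) w = w` for `w ∈ ℓ_Δ`. [cite: Kudla1994, §3] -/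
theorem iotaD_apply_of_mem_deltaLagrangian (g : UnitaryGroup.localPi E c (n + n) JD v) (t : Matrix (Fin n) (Fin n) (LocalRing E v))
    (hg : adapt (matA F E c v n g) = Matrix.fromBlocks 1 t 0 1)
    {w : (Fin (n + n) → v.adicCompletion F) × (Fin (n + n) → v.adicCompletion F)} (hw : w ∈ deltaLagrangian F v n) :
    toLin F v (iotaD F E c hcδ hδ hd v n hT₀ hJD g) w = w := by
  rw [← map_eD_deltaV F E c hcδ hδ hd v n] at hw
  obtain ⟨u, hu, rfl⟩ := hw
  obtain ⟨a, rfl⟩ := (mem_deltaV_iff_exists F E v n u).1 hu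
  change toLin F v (iotaD F E c hcδ hδ hd v n hT₀ hJD g) (eD F E c hcδ hδ hd v n (dblV a)) = eD F E c hcδ hδ hd v n (dblV a)
  rw [iotaD_apply_eD F E c hcδ hδ hd v n hT₀ hJD g t hg, halfDiff_dblV, Matrix.mulVec_zero, dblV_zero, map_zero, add_zero]

include hT₀ hJD in
/-- **an adapted unipotent is trivial modulo `ℓ_Δ`**: `ι(g) w − w ∈ ℓ_Δ` for every `w ∈ 𝕎_v`. [cite: Kudla1994, §3] -/
theorem iotaD_apply_sub_mem_deltaLagrangian (g : UnitaryGroup.localPi E c (n + n) JD v) (t : Matrix (Fin n) (Fin n) (LocalRing E v))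
    (hg : adapt (matA F E c v n g) = Matrix.fromBlocks 1 t 0 1)
    (w : (Fin (n + n) → v.adicCompletion F) × (Fin (n + n) → v.adicCompletion F)) :
    toLin F v (iotaD F E c hcδ hδ hd v n hT₀ hJD g) w - w ∈ deltaLagrangian F v n := by
  obtain ⟨u, rfl⟩ := (eD F E c hcδ hδ hd v n).surjective w
  rw [iotaD_apply_eD F E c hcδ hδ hd v n hT₀ hJD g t hg, add_sub_cancel_left, ← map_eD_deltaV F E c hcδ hδ hd v n]
  exact Submodule.mem_map_of_mem (dblV_mem_deltaV F E v n _)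

/-! ## §2 Conjugation by a mover `E′` (`E′ ℓ_Δ = ℓ_Y`): the image lies in the unipotent radical of `P_Y` -/

include hT₀ hJD in
/-- **the conjugate of an adapted unipotent by a mover**: `(E′ ι(g) E′⁻¹) w = w + E′ (eD (dblV (t · halfDiff (eD⁻¹ (E′⁻¹ w)))))`.
[cite: Kudla1994, §3; Rangarao1993, §2.2, p. 338] -/
theorem mover_conj_apply (g : UnitaryGroup.localPi E c (n + n) JD v) (t : Matrix (Fin n) (Fin n) (LocalRing E v))
    (hg : adapt (matA F E c v n g) = Matrix.fromBlocks 1 t 0 1) (E' : LocalSp F (n + n) (gramD F n T₀) v)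
    (w : (Fin (n + n) → v.adicCompletion F) × (Fin (n + n) → v.adicCompletion F)) :
    toLin F v (E' * iotaD F E c hcδ hδ hd v n hT₀ hJD g * E'⁻¹) w =
      w + toLin F v E' (eD F E c hcδ hδ hd v n (dblV (t *ᵥ halfDiff ((eD F E c hcδ hδ hd v n).symm (toLin F v E'⁻¹ w))))) := by
  set u := (eD F E c hcδ hδ hd v n).symm (toLin F v E'⁻¹ w) with hu
  have hw : toLin F v E'⁻¹ w = eD F E c hcδ hδ hd v n u := by rw [hu, LinearEquiv.apply_symm_apply]
  have hEE : toLin F v E' (toLin F v E'⁻¹ w) = w := by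
    simp only [LinearEquiv.coe_coe, Subgroup.coe_inv, LinearEquiv.coe_inv, LinearEquiv.apply_symm_apply]
  calc toLin F v (E' * iotaD F E c hcδ hδ hd v n hT₀ hJD g * E'⁻¹) w
      = toLin F v E' (toLin F v (iotaD F E c hcδ hδ hd v n hT₀ hJD g) (toLin F v E'⁻¹ w)) := by
        simp only [LinearEquiv.coe_coe, Subgroup.coe_mul, LinearEquiv.mul_apply]
    _ = toLin F v E' (eD F E c hcδ hδ hd v n u + eD F E c hcδ hδ hd v n (dblV (t *ᵥ halfDiff u))) := by
        rw [hw, iotaD_apply_eD F E c hcδ hδ hd v n hT₀ hJD g t hg]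
    _ = w + toLin F v E' (eD F E c hcδ hδ hd v n (dblV (t *ᵥ halfDiff u))) := by rw [map_add, ← hw, hEE]

include hT₀ hJD in
/-- **the conjugate fixes `ℓ_Y` pointwise**: `(E′ ι(g) E′⁻¹) w = w` for `w ∈ ℓ_Y` (`E′⁻¹ w ∈ ℓ_Δ` is fixed by `ι(g)`).
[cite: Kudla1994, §3; Rangarao1993, §2.2, p. 338] -/
theorem mover_conj_apply_of_mem_lagrangianY (g : UnitaryGroup.localPi E c (n + n) JD v) (t : Matrix (Fin n) (Fin n) (LocalRing E v))
    (hg : adapt (matA F E c v n g) = Matrix.fromBlocks 1 t 0 1) (E' : LocalSp F (n + n) (gramD F n T₀) v)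
    (hE' : (deltaLagrangian F v n).map (toLin F v E') = lagrangianY F (n + n) v)
    {w : (Fin (n + n) → v.adicCompletion F) × (Fin (n + n) → v.adicCompletion F)} (hw : w ∈ lagrangianY F (n + n) v) :
    toLin F v (E' * iotaD F E c hcδ hδ hd v n hT₀ hJD g * E'⁻¹) w = w := by
  have hw' : toLin F v E'⁻¹ w ∈ deltaLagrangian F v n := by
    rw [← map_coe_inv_of_map_eq hE']
    exact Submodule.mem_map_of_mem hw
  have hEE : toLin F v E' (toLin F v E'⁻¹ w) = w := by
    simp only [LinearEquiv.coe_coe, Subgroup.coe_inv, LinearEquiv.coe_inv, LinearEquiv.apply_symm_apply]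
  calc toLin F v (E' * iotaD F E c hcδ hδ hd v n hT₀ hJD g * E'⁻¹) w
      = toLin F v E' (toLin F v (iotaD F E c hcδ hδ hd v n hT₀ hJD g) (toLin F v E'⁻¹ w)) := by
        simp only [LinearEquiv.coe_coe, Subgroup.coe_mul, LinearEquiv.mul_apply]
    _ = w := by rw [iotaD_apply_of_mem_deltaLagrangian F E c hcδ hδ hd v n hT₀ hJD g t hg hw', hEE]

include hT₀ hJD in
/-- **the conjugate is trivial modulo `ℓ_Y`**: the `X`-component is unchanged, `((E′ ι(g) E′⁻¹) w).1 = w.1` (`ι(g) u − u ∈ ℓ_Δ`, `E′ ℓ_Δ = ℓ_Y = {x = 0}`).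
[cite: Kudla1994, §3; Rangarao1993, §2.2, p. 338] -/
theorem fst_mover_conj_apply (g : UnitaryGroup.localPi E c (n + n) JD v) (t : Matrix (Fin n) (Fin n) (LocalRing E v))
    (hg : adapt (matA F E c v n g) = Matrix.fromBlocks 1 t 0 1) (E' : LocalSp F (n + n) (gramD F n T₀) v)
    (hE' : (deltaLagrangian F v n).map (toLin F v E') = lagrangianY F (n + n) v)
    (w : (Fin (n + n) → v.adicCompletion F) × (Fin (n + n) → v.adicCompletion F)) :
    (toLin F v (E' * iotaD F E c hcδ hδ hd v n hT₀ hJD g * E'⁻¹) w).1 = w.1 := by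
  have hmem : toLin F v E' (eD F E c hcδ hδ hd v n (dblV (t *ᵥ halfDiff ((eD F E c hcδ hδ hd v n).symm (toLin F v E'⁻¹ w))))) ∈
      lagrangianY F (n + n) v := by
    rw [← hE']
    refine Submodule.mem_map_of_mem ?_
    rw [← map_eD_deltaV F E c hcδ hδ hd v n]
    exact Submodule.mem_map_of_mem (dblV_mem_deltaV F E v n _)
  rw [lagrangianY, Submodule.mem_prod, Submodule.mem_bot] at hmem
  rw [mover_conj_apply F E c hcδ hδ hd v n hT₀ hJD g t hg E' w, Prod.fst_add, hmem.1, add_zero]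

include hT₀ hT₀d hJD in
/-- **FOR EVERY MOVER `E′`, THE CONJUGATE OF AN ADAPTED UNIPOTENT IS A TRANSPORTED SIEGEL UNIPOTENT**:
`E′ ι(g) E′⁻¹ = transportSp 𝕋 (low c)` with `c = cOfFix 𝕋 (E′ ι(g) E′⁻¹) = 𝕋 · Mat(x ↦ ((E′ ι(g) E′⁻¹)(x,0)).2)` symmetric
(★ `SymplecticMatrix.eq_transportSp_low_of_fix`) — the hypothesis `hB` of ★ `leraySection_deltaLagrangian_apply_eq_conj_unipOpPi`.
[cite: Kudla1994, §3, Thm 3.1; Rangarao1993, §2.2, p. 338, Lemma 3.2 (3.8), p. 351] -/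
theorem mover_conj_iotaD_eq_transportSp_low (g : UnitaryGroup.localPi E c (n + n) JD v) (t : Matrix (Fin n) (Fin n) (LocalRing E v))
    (hg : adapt (matA F E c v n g) = Matrix.fromBlocks 1 t 0 1) (E' : LocalSp F (n + n) (gramD F n T₀) v)
    (hE' : (deltaLagrangian F v n).map (toLin F v E') = lagrangianY F (n + n) v) :
    E' * iotaD F E c hcδ hδ hd v n hT₀ hJD g * E'⁻¹ =
      transportSp (localGram F (n + n) (gramD F n T₀) v) (isUnit_det_localGram_gramD F v n hT₀d)
        (low (cOfFix (localGram F (n + n) (gramD F n T₀) v) (E' * iotaD F E c hcδ hδ hd v n hT₀ hJD g * E'⁻¹))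
          (isSymm_cOfFix (localGram F (n + n) (gramD F n T₀) v) _
            (fun x => fst_mover_conj_apply F E c hcδ hδ hd v n hT₀ hJD g t hg E' hE' (x, 0)))) := by
  haveI : CharZero (v.adicCompletion F) := charZero_of_injective_algebraMap (algebraMap F (v.adicCompletion F)).injective
  haveI : Invertible (2 : v.adicCompletion F) := invertibleOfNonzero two_ne_zero
  exact eq_transportSp_low_of_fix (localGram F (n + n) (gramD F n T₀) v) (isUnit_det_localGram_gramD F v n hT₀d) _
    (fun y => mover_conj_apply_of_mem_lagrangianY F E c hcδ hδ hd v n hT₀ hJD g t hg E' hE'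
      (by rw [lagrangianY, Submodule.mem_prod, Submodule.mem_bot]; exact ⟨rfl, Submodule.mem_top⟩))
    (fun x => fst_mover_conj_apply F E c hcδ hδ hd v n hT₀ hJD g t hg E' hE' (x, 0))

include hT₀ hJD in
/-- **THE UNIPOTENT MODEL JUNCTION**: for Rao's Leray section `r` at `ℓ_Δ` of the doubled Schrödinger model, ANY mover `E′` with an implementer
`Γ`, and an adapted unipotent `g ∈ H(F_v)` (`adapt (matA g) = [[1,t],[0,1]]`):
`r(ι(g)) Φ = Γ⁻¹ (unipOpPi (c ·) (Γ Φ))`, `c = cOfFix 𝕋 (E′ ι(g) E′⁻¹)` (★ `leraySection_deltaLagrangian_apply_eq_conj_unipOpPi` + §2).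
[cite: Kudla1994, §3, Thm 3.1; Rangarao1993, Lemma 3.2 (3.8), Thm 4.1; MoeglinVignerasWaldspurger1987, Chap. 2 II.6] -/
theorem leraySection_iotaD_adaptedUnipotent_apply
    [MeasurableSpace (v.adicCompletion F)] [BorelSpace (v.adicCompletion F)]
    (μ : Measure (v.adicCompletion F)) [μ.IsAddHaarMeasure]
    (hU : ImplementerUniqueUpToScalar (localSchrodinger F (n + n) (gramD F n T₀) v))
    (r : ImplementerSection (localSchrodinger F (n + n) (gramD F n T₀) v))
    (hr : ∀ g₁ g₂ : LocalSp F (n + n) (gramD F n T₀) v, r.cocycle hU g₁ g₂ =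
      localLeray F (n + n) (gramD F n T₀) (isUnit_det_gramD F n hT₀d) v μ ((adeleAddCharAt F v).mulShift (⅟(2 : (v.adicCompletion F))))
        (isContinuousNontrivial_adeleAddCharAt_half F v) (deltaLagrangian F v n)
        (deltaLagrangian_orthogonal F v n T₀ hT₀d) g₁ g₂)
    (E' : LocalSp F (n + n) (gramD F n T₀) v) (hE' : (deltaLagrangian F v n).map (toLin F v E') = lagrangianY F (n + n) v)
    (Γ : (SchwartzBruhat (Fin (n + n) → v.adicCompletion F)) ≃ₗ[ℂ] (SchwartzBruhat (Fin (n + n) → v.adicCompletion F)))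
    (hΓ : Implements (localSchrodinger F (n + n) (gramD F n T₀) v) (ofSymplectic _ E') Γ)
    (g : UnitaryGroup.localPi E c (n + n) JD v) (t : Matrix (Fin n) (Fin n) (LocalRing E v))
    (hg : adapt (matA F E c v n g) = Matrix.fromBlocks 1 t 0 1)
    (Φ : (SchwartzBruhat (Fin (n + n) → v.adicCompletion F))) :
    r (iotaD F E c hcδ hδ hd v n hT₀ hJD g) Φ =
      Γ.symm (unipOpPi (isLocallyConstant_of_isContinuousNontrivial (isContinuousNontrivial_adeleAddCharAt F v))
        (Matrix.mulVecLin (cOfFix (localGram F (n + n) (gramD F n T₀) v) (E' * iotaD F E c hcδ hδ hd v n hT₀ hJD g * E'⁻¹))) (Γ Φ)) :=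
  leraySection_deltaLagrangian_apply_eq_conj_unipOpPi F v μ n hT₀d hU r hr E' Γ hΓ (iotaD F E c hcδ hδ hd v n hT₀ hJD g)
    (by
      -- `ι(g)` fixes `ℓ_Δ` (it fixes it pointwise)
      apply le_antisymm
      · rintro _ ⟨w, hw, rfl⟩
        rw [iotaD_apply_of_mem_deltaLagrangian F E c hcδ hδ hd v n hT₀ hJD g t hg hw]; exact hw
      · intro w hw
        exact ⟨w, hw, iotaD_apply_of_mem_deltaLagrangian F E c hcδ hδ hd v n hT₀ hJD g t hg hw⟩)
    _ _ (mover_conj_iotaD_eq_transportSp_low F E c hcδ hδ hd v n hT₀ hT₀d hJD g t hg E' hE') Φ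

/-! ## §3 Linearity of the Rao parameter in `t` and its quadratic form -/

omit [Algebra.IsQuadraticExtension F E] in
/-- `dblV` commutes with the `F_v`-scalars of `E ⊗ F_v`. [cite: HarrisKudlaSweet1996, §1 (1.11)] -/
theorem dblV_smul_adicCompletion (r : v.adicCompletion F) (z : Fin n → LocalRing E v) : dblV (r • z) = r • dblV z := by
  funext k
  rcases k with i | i <;> simp [dblV]

include hT₀ hJD in
/-- **the shear of the conjugate is `F_v`-linear in the parameter**: for adapted unipotents `g₁` (parameter `t`) and `g₂` (parameter `r • t`),
`shearMap 𝕋 (E′ ι(g₂) E′⁻¹) = r • shearMap 𝕋 (E′ ι(g₁) E′⁻¹)`. [cite: Kudla1994, §3; Rangarao1993, §2.2, p. 338] -/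
theorem shearMap_mover_conj_smul (g₁ g₂ : UnitaryGroup.localPi E c (n + n) JD v) (t : Matrix (Fin n) (Fin n) (LocalRing E v))
    (r : v.adicCompletion F) (hg₁ : adapt (matA F E c v n g₁) = Matrix.fromBlocks 1 t 0 1)
    (hg₂ : adapt (matA F E c v n g₂) = Matrix.fromBlocks 1 (r • t) 0 1) (E' : LocalSp F (n + n) (gramD F n T₀) v) :
    shearMap (localGram F (n + n) (gramD F n T₀) v) (E' * iotaD F E c hcδ hδ hd v n hT₀ hJD g₂ * E'⁻¹) =
      r • shearMap (localGram F (n + n) (gramD F n T₀) v) (E' * iotaD F E c hcδ hδ hd v n hT₀ hJD g₁ * E'⁻¹) := by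
  apply LinearMap.ext
  intro x
  rw [LinearMap.smul_apply, shearMap_apply, shearMap_apply]
  change (toLin F v (E' * iotaD F E c hcδ hδ hd v n hT₀ hJD g₂ * E'⁻¹) (x, 0)).2 =
    r • (toLin F v (E' * iotaD F E c hcδ hδ hd v n hT₀ hJD g₁ * E'⁻¹) (x, 0)).2
  rw [mover_conj_apply F E c hcδ hδ hd v n hT₀ hJD g₂ (r • t) hg₂ E', mover_conj_apply F E c hcδ hδ hd v n hT₀ hJD g₁ t hg₁ E',
    Matrix.smul_mulVec, dblV_smul_adicCompletion, map_smul, map_smul]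
  simp only [Prod.snd_add, Prod.smul_snd, zero_add]

include hT₀ hJD in
/-- **the Rao parameter is `F_v`-linear in `t`**: `cOfFix 𝕋 (E′ ι(g₂) E′⁻¹) = r • cOfFix 𝕋 (E′ ι(g₁) E′⁻¹)` for adapted unipotents of parameters
`t` and `r • t` (so on a line `t = b • t₀` the conjugates are `n(b • c₁)`, the hypothesis shape of ★ S1). [cite: Kudla1994, §3; Rangarao1993, Lemma 3.2 (3.8), p. 351] -/
theorem cOfFix_mover_conj_smul (g₁ g₂ : UnitaryGroup.localPi E c (n + n) JD v) (t : Matrix (Fin n) (Fin n) (LocalRing E v))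
    (r : v.adicCompletion F) (hg₁ : adapt (matA F E c v n g₁) = Matrix.fromBlocks 1 t 0 1)
    (hg₂ : adapt (matA F E c v n g₂) = Matrix.fromBlocks 1 (r • t) 0 1) (E' : LocalSp F (n + n) (gramD F n T₀) v) :
    cOfFix (localGram F (n + n) (gramD F n T₀) v) (E' * iotaD F E c hcδ hδ hd v n hT₀ hJD g₂ * E'⁻¹) =
      r • cOfFix (localGram F (n + n) (gramD F n T₀) v) (E' * iotaD F E c hcδ hδ hd v n hT₀ hJD g₁ * E'⁻¹) := by
  rw [cOfFix, cOfFix, shearMap_mover_conj_smul F E c hcδ hδ hd v n hT₀ hJD g₁ g₂ t r hg₁ hg₂ E', map_smul, Matrix.mul_smul]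

include hT₀ hJD in
/-- **the quadratic form of the Rao parameter is the doubled symplectic form on the conjugated orbit**:
`⟨x, c x⟩ = A(eD u, ι(g) (eD u)) = formD (u, matA g · u)` with `u = eD⁻¹ (E′⁻¹ (x, 0))` (★ `dotProduct_cOfFix_mulVec_self_eq_alt`, `E′ ∈ Sp`,
★ `eD_matA_mulVec`) — by ★ `formD_dblV_adblV` this is `im (2 · b̄ᵀ 𝕋₀ t b)` on the `Δ⁻`-component `b = halfDiff u`, the input of the anisotropy transfer (AN).
[cite: Kudla1994, §3; HarrisKudlaSweet1996, §1 (1.11); Rangarao1993, Lemma 3.2 (3.8), p. 351] -/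
theorem dotProduct_cOfFix_mover_conj (g : UnitaryGroup.localPi E c (n + n) JD v) (E' : LocalSp F (n + n) (gramD F n T₀) v)
    (x : Fin (n + n) → v.adicCompletion F) :
    x ⬝ᵥ cOfFix (localGram F (n + n) (gramD F n T₀) v) (E' * iotaD F E c hcδ hδ hd v n hT₀ hJD g * E'⁻¹) *ᵥ x =
      formD F E c hcδ hδ hd v n T₀ ((eD F E c hcδ hδ hd v n).symm (toLin F v E'⁻¹ (x, 0)))
        (matA F E c v n g *ᵥ (eD F E c hcδ hδ hd v n).symm (toLin F v E'⁻¹ (x, 0))) := by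
  set u := (eD F E c hcδ hδ hd v n).symm (toLin F v E'⁻¹ (x, 0)) with hu
  have hw : toLin F v E'⁻¹ (x, 0) = eD F E c hcδ hδ hd v n u := by rw [hu, LinearEquiv.apply_symm_apply]
  have hiso := (Heisenberg.PseudoSymplectic.mem_isometries _ _).1 E'.2 (toLin F v E'⁻¹ (x, 0))
    (toLin F v (iotaD F E c hcδ hδ hd v n hT₀ hJD g) (toLin F v E'⁻¹ (x, 0)))
  rw [formD_apply, eD_matA_mulVec F E c hcδ hδ hd v n hT₀ hJD, ← hw, ← hiso, dotProduct_cOfFix_mulVec_self_eq_alt]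
  -- both sides are `A((x,0), E′ (ι(g) (E′⁻¹ (x,0))))`
  simp only [LinearEquiv.coe_coe, Subgroup.coe_mul, Subgroup.coe_inv, LinearEquiv.mul_apply, LinearEquiv.coe_inv,
    LinearEquiv.apply_symm_apply]

/-! ## §4 The named Siegel unipotents `n(t)` (★ `nElem`) -/

include hcδ hδ hd hT₀ hT₀d in
/-- **`E′ ι(n(t)) E′⁻¹ = transportSp 𝕋 (low (cOfFix 𝕋 (E′ ι(n(t)) E′⁻¹)))`** for the tree's Siegel unipotent `nElem t ht` (adapted matrix `[[1,t],[0,1]]`,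
★ `adapt_matA_nElem`) and EVERY mover `E′`. [cite: Kudla1994, §3, Thm 3.1; Rangarao1993, §2.2, p. 338] -/
theorem mover_conj_iotaD_nElem_eq_transportSp_low (t : Matrix (Fin n) (Fin n) (LocalRing E v))
    (ht : (t.map (conjLocal E c v))ᵀ * gramS F E v n T₀ + gramS F E v n T₀ * t = 0) (E' : LocalSp F (n + n) (gramD F n T₀) v)
    (hE' : (deltaLagrangian F v n).map (toLin F v E') = lagrangianY F (n + n) v) :
    E' * iotaD F E c hcδ hδ hd v n hT₀ hJD (nElem F E c v n hJD t ht) * E'⁻¹ =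
      transportSp (localGram F (n + n) (gramD F n T₀) v) (isUnit_det_localGram_gramD F v n hT₀d)
        (low (cOfFix (localGram F (n + n) (gramD F n T₀) v) (E' * iotaD F E c hcδ hδ hd v n hT₀ hJD (nElem F E c v n hJD t ht) * E'⁻¹))
          (isSymm_cOfFix (localGram F (n + n) (gramD F n T₀) v) _
            (fun x => fst_mover_conj_apply F E c hcδ hδ hd v n hT₀ hJD _ t (adapt_matA_nElem F E c v n hJD t ht) E' hE' (x, 0)))) :=
  mover_conj_iotaD_eq_transportSp_low F E c hcδ hδ hd v n hT₀ hT₀d hJD _ t (adapt_matA_nElem F E c v n hJD t ht) E' hE'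

include hT₀ hJD in
/-- **`r(ι(n(t))) Φ = Γ⁻¹ (unipOpPi (c ·) (Γ Φ))`, `c = cOfFix 𝕋 (E′ ι(n(t)) E′⁻¹)`** — the unipotent model junction on the tree's `nElem t ht`
(and, through ★ `kronLoc_nElem`, on the Kronecker images of the rank-one Siegel unipotents), for ANY mover `E′` with implementer `Γ`.
[cite: Kudla1994, §3, Thm 3.1; Rangarao1993, Lemma 3.2 (3.8), Thm 4.1; MoeglinVignerasWaldspurger1987, Chap. 2 II.6] -/
theorem leraySection_iotaD_nElem_apply
    [MeasurableSpace (v.adicCompletion F)] [BorelSpace (v.adicCompletion F)]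
    (μ : Measure (v.adicCompletion F)) [μ.IsAddHaarMeasure]
    (hU : ImplementerUniqueUpToScalar (localSchrodinger F (n + n) (gramD F n T₀) v))
    (r : ImplementerSection (localSchrodinger F (n + n) (gramD F n T₀) v))
    (hr : ∀ g₁ g₂ : LocalSp F (n + n) (gramD F n T₀) v, r.cocycle hU g₁ g₂ =
      localLeray F (n + n) (gramD F n T₀) (isUnit_det_gramD F n hT₀d) v μ ((adeleAddCharAt F v).mulShift (⅟(2 : (v.adicCompletion F))))
        (isContinuousNontrivial_adeleAddCharAt_half F v) (deltaLagrangian F v n)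
        (deltaLagrangian_orthogonal F v n T₀ hT₀d) g₁ g₂)
    (E' : LocalSp F (n + n) (gramD F n T₀) v) (hE' : (deltaLagrangian F v n).map (toLin F v E') = lagrangianY F (n + n) v)
    (Γ : (SchwartzBruhat (Fin (n + n) → v.adicCompletion F)) ≃ₗ[ℂ] (SchwartzBruhat (Fin (n + n) → v.adicCompletion F)))
    (hΓ : Implements (localSchrodinger F (n + n) (gramD F n T₀) v) (ofSymplectic _ E') Γ)
    (t : Matrix (Fin n) (Fin n) (LocalRing E v)) (ht : (t.map (conjLocal E c v))ᵀ * gramS F E v n T₀ + gramS F E v n T₀ * t = 0)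
    (Φ : (SchwartzBruhat (Fin (n + n) → v.adicCompletion F))) :
    r (iotaD F E c hcδ hδ hd v n hT₀ hJD (nElem F E c v n hJD t ht)) Φ =
      Γ.symm (unipOpPi (isLocallyConstant_of_isContinuousNontrivial (isContinuousNontrivial_adeleAddCharAt F v))
        (Matrix.mulVecLin (cOfFix (localGram F (n + n) (gramD F n T₀) v)
          (E' * iotaD F E c hcδ hδ hd v n hT₀ hJD (nElem F E c v n hJD t ht) * E'⁻¹))) (Γ Φ)) :=
  leraySection_iotaD_adaptedUnipotent_apply F E c hcδ hδ hd v n hT₀ hT₀d hJD μ hU r hr E' hE' Γ hΓ _ t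
    (adapt_matA_nElem F E c v n hJD t ht) Φ

end Literature.NumberTheory.GelbartRogawski1991.UnitaryDualPair.LocalSplitting

end
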